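import Literature.Geometry.Lorentzian.LandauLifshitzPseudotensor
import Mathlib.LinearAlgebra.Matrix.SchurComplement

/-!
# Route EIHFluxBalance — `EIHFluxEvaluation` (c): Kerr–Schild algebra of the Landau–Lifshitz
# superpotential along the mass family `η + s K`

Helper file (`--supports stmt-FinalStateConjecture-10188`) for the informal support item
`EIHFluxEvaluation` of route `EIHFluxBalance`, clause (c) ("for exact boosted Kerr the
Landau–Lifshitz fluxes vanish identically"). Pointwise ALGEBRA of a **Kerr–Schild family**
`g_s = η + s K`, where the value `K y = φ ℓ ⊗ ℓ` is a null rank-one form (`ℓ` is `η`-null;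
Kerr–Schild 1965, §1; for Kerr `K = 2H ℓ ⊗ ℓ` with `H, ℓ` independent of the mass, so `s` is the
mass): at such a point

* `gram` is `D + s φ l lᵀ` (`D = diag(−1,1,1,1)`, `l_μ = ℓ(∂_μ)`), `det (g_{μν}) = −1` for ALL `s`
  (matrix determinant lemma, `lᵀ D l = 0`), the inverse is `D − s φ n nᵀ` with `n = D l`
  (`upper_ksFamily`) — the classical `g^{μν} = η^{μν} − 2H ℓ^μ ℓ^ν`;
* consequently the Landau–Lifshitz superpotential `H^{μβνα} = −g (g^{μν}g^{βα} − g^{βν}g^{μα})`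
  is **AFFINE in `s`**: the `s²`-coefficient is `φ²(n^μ n^ν n^β n^α − n^β n^ν n^μ n^α) = 0`, and the
  `s`-coefficient is the first value-derivative of `H` at `(D, −1)` in the direction of the
  components `X = (K_{ρσ})` — literally the `T`-linear expression of
  `Literature.…LandauLifshitz.principalPart_cancel` with `U = D`, `d = −1`, `T = X`
  (`superpotential_ksFamily`).

This affinity is the algebraic reason why the Landau–Lifshitz complex of a Kerr–Schild vacuum
family vanishes (Gürses–Gürsey, J. Math. Phys. 16 (1975) 2385, §IV: the pseudotensorial parts
drop out in Kerr–Schild coordinates); the analytic half is in the companion files.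
-/

noncomputable section

open Filter Set
open scoped Matrix Topology ContDiff

namespace Summit.FinalStateConjecture.FinalStateConjecture.Theorems

namespace KSFlux

open Literature.Geometry.Lorentzian Literature.Geometry.Lorentzian.LandauLifshitz

variable {K : E4 → E4 →L[ℝ] E4 →L[ℝ] ℝ}

/-! ### The null rank-one structure at a point, in components -/

/-- Components of a null rank-one value: if `K y = φ ℓ ⊗ ℓ` with `η(n, ·) = ℓ` and `ℓ(n) = 0`,
then with `l_μ = ℓ(∂_μ)`: `K y (∂_μ, ∂_ν) = φ l_μ l_ν`, `n_μ = D_{μμ} l_μ` and `Σ_μ D_{μμ} l_μ² = 0`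
(Kerr–Schild 1965, §1: `ℓ` is null for `η`). [cite: KerrSchild1965, §1] -/
theorem nullRankOne_components {y : E4} {φ : ℝ} {ℓ : E4 →L[ℝ] ℝ} {n : E4}
    (hn : ∀ w, Minkowski.bilin n w = ℓ w) (hℓ : ℓ n = 0) (hK : K y = φ • E4.tmul ℓ ℓ) :
    (∀ μ ν : Fin 4, K y (E4.basisVector μ) (E4.basisVector ν) =
        φ * ℓ (E4.basisVector μ) * ℓ (E4.basisVector ν)) ∧
      (∀ μ : Fin 4, n μ = (![(-1 : ℝ), 1, 1, 1] : Fin 4 → ℝ) μ * ℓ (E4.basisVector μ)) ∧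
      ∑ μ : Fin 4, (![(-1 : ℝ), 1, 1, 1] : Fin 4 → ℝ) μ * (ℓ (E4.basisVector μ)) ^ 2 = 0 := by
  have hcomp : ∀ μ : Fin 4, n μ = (![(-1 : ℝ), 1, 1, 1] : Fin 4 → ℝ) μ * ℓ (E4.basisVector μ) := by
    intro μ
    have h := hn (E4.basisVector μ)
    fin_cases μ <;> simp [Fin.sum_univ_three, Fin.succ_ne_zero] at h ⊢ <;> linarith
  refine ⟨fun μ ν ↦ ?_, hcomp, ?_⟩
  · rw [hK]
    simp [E4.tmul_apply, mul_assoc]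
  · -- `ℓ n = Σ_μ n_μ ℓ(∂_μ) = Σ_μ D_{μμ} l_μ²`
    have hexp : ℓ n = ∑ μ : Fin 4, n μ * ℓ (E4.basisVector μ) := by
      conv_lhs => rw [show n = ∑ μ : Fin 4, n μ • E4.basisVector μ from by
        ext i; simp [E4.basisVector, Finset.sum_apply, Pi.single_apply]]
      rw [map_sum]
      simp [smul_eq_mul]
    rw [hexp] at hℓ
    simp only [hcomp] at hℓ
    rw [← hℓ]
    refine Finset.sum_congr rfl fun μ _ ↦ ?_
    ring

/-! ### The components, determinant and inverse along the family -/

/-- The Minkowski matrix of this file is the one of `gram_minkowski`. [folklore] -/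
theorem diag_signs_eq :
    ((Matrix.diagonal ![(-1 : ℝ), 1, 1, 1]) : Matrix (Fin 4) (Fin 4) ℝ) = Matrix.diagonal fun μ :
        Fin 4 ↦ if μ = 0 then (-1 : ℝ) else 1 := by
  congr 1
  funext μ
  fin_cases μ <;> simp

/-- `D² = 1`. [folklore] -/
theorem diag_signs_mul_self : ((Matrix.diagonal ![(-1 : ℝ), 1, 1, 1]) : Matrix (Fin 4) (Fin 4) ℝ) *
    (Matrix.diagonal ![(-1 : ℝ), 1, 1, 1]) = 1 := by
  rw [Matrix.diagonal_mul_diagonal, ← Matrix.diagonal_one]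
  congr 1
  funext μ
  fin_cases μ <;> simp

/-- `det D = −1`. [folklore] -/
theorem det_diag_signs : Matrix.det ((Matrix.diagonal ![(-1 : ℝ), 1, 1, 1]) : Matrix (Fin 4) (Fin
    4) ℝ) = -1 := by
  rw [Matrix.det_diagonal, Fin.prod_univ_four]
  simp

/-- `D⁻¹ = D`. [folklore] -/
theorem inv_diag_signs : ((Matrix.diagonal ![(-1 : ℝ), 1, 1, 1]) : Matrix (Fin 4) (Fin 4) ℝ)⁻¹ =
    (Matrix.diagonal ![(-1 : ℝ), 1, 1, 1]) :=
  Matrix.inv_eq_left_inv diag_signs_mul_self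

/-- **Components of the Kerr–Schild family**: `(g_s)_{μν}(y) = D_{μν} + s K_{μν}(y)`.
[cite: KerrSchild1965, §1] -/
theorem gram_ksFamily (s : ℝ) (y : E4) :
    gram (fun z ↦ Minkowski.bilin + s • K z) y = (Matrix.diagonal ![(-1 : ℝ), 1, 1, 1]) + s • gram
        K y := by
  rw [diag_signs_eq, ← gram_minkowski y]
  ext μ ν
  simp [gram]

/-- **`det (g_s)_{μν} = −1` for every `s`** at a null rank-one point (matrix determinant lemma:
`det (D + u lᵀ) = det D · (1 + lᵀ D⁻¹ u)` and `lᵀ D l = 0`). Kerr–Schild 1965, §1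
(`√−g = 1` in Kerr–Schild coordinates). [cite: KerrSchild1965, §1] -/
theorem metricDet_ksFamily {y : E4} {φ : ℝ} {ℓ : E4 →L[ℝ] ℝ} {n : E4}
    (hn : ∀ w, Minkowski.bilin n w = ℓ w) (hℓ : ℓ n = 0) (hK : K y = φ • E4.tmul ℓ ℓ) (s : ℝ) :
    metricDet (fun z ↦ Minkowski.bilin + s • K z) y = -1 := by
  obtain ⟨hKc, -, hnull⟩ := nullRankOne_components hn hℓ hK
  set l : Fin 4 → ℝ := fun μ ↦ ℓ (E4.basisVector μ) with hl
  have hgram : gram (fun z ↦ Minkowski.bilin + s • K z) y =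
      (Matrix.diagonal ![(-1 : ℝ), 1, 1, 1]) + Matrix.replicateCol Unit ((s * φ) • l) *
          Matrix.replicateRow Unit l := by
    rw [gram_ksFamily]
    ext μ ν
    simp [Matrix.mul_apply, gram, hKc, hl]
    ring
  have hunit : IsUnit (Matrix.det ((Matrix.diagonal ![(-1 : ℝ), 1, 1, 1]) : Matrix (Fin 4) (Fin 4)
      ℝ)) := by
    rw [det_diag_signs]; norm_num
  rw [metricDet, hgram, Matrix.det_add_replicateCol_mul_replicateRow hunit, det_diag_signs,
    inv_diag_signs, Matrix.det_unique]
  have hentry : (Matrix.replicateRow Unit l * (Matrix.diagonal ![(-1 : ℝ), 1, 1, 1]) *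
      Matrix.replicateCol Unit ((s * φ) • l))
      default default = (s * φ) * ∑ μ : Fin 4, (![(-1 : ℝ), 1, 1, 1] : Fin 4 → ℝ) μ * l μ ^ 2 := by
    simp [Matrix.mul_apply, Matrix.diagonal, Fin.sum_univ_four]
    ring
  rw [Matrix.add_apply, Matrix.one_apply_eq, hentry, hnull]
  ring

/-- **The inverse components of the Kerr–Schild family**: `(g_s)^{μν}(y) = D_{μν} − s φ n_μ n_ν`,
`n = D l` (`g^{μν} = η^{μν} − 2H ℓ^μ ℓ^ν`, Kerr–Schild 1965, §1), for every `s`.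
[cite: KerrSchild1965, §1] -/
theorem upper_ksFamily {y : E4} {φ : ℝ} {ℓ : E4 →L[ℝ] ℝ} {n : E4}
    (hn : ∀ w, Minkowski.bilin n w = ℓ w) (hℓ : ℓ n = 0) (hK : K y = φ • E4.tmul ℓ ℓ) (s : ℝ) :
    upper (fun z ↦ Minkowski.bilin + s • K z) y =
      (Matrix.diagonal ![(-1 : ℝ), 1, 1, 1]) - Matrix.of fun μ ν ↦ s * φ * n μ * n ν := by
  obtain ⟨hKc, hcomp, hnull⟩ := nullRankOne_components hn hℓ hK
  rw [upper, gram_ksFamily]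
  refine Matrix.inv_eq_right_inv ?_
  -- each entry of `(D + sX)(D − sφ n nᵀ) − 1` is `−s²φ² l_μ n_ν · (lᵀ D l)`, which vanishes
  have key : ∀ μ ν : Fin 4,
      (((Matrix.diagonal ![(-1 : ℝ), 1, 1, 1]) + s • gram K y) * ((Matrix.diagonal ![(-1 : ℝ), 1,
          1, 1]) - Matrix.of fun μ ν ↦ s * φ * n μ * n ν)) μ ν -
          (1 : Matrix (Fin 4) (Fin 4) ℝ) μ ν =
        -(s ^ 2 * φ ^ 2) * ℓ (E4.basisVector μ) * ((![(-1 : ℝ), 1, 1, 1] : Fin 4 → ℝ) ν * ℓ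
            (E4.basisVector ν)) *
          ∑ κ : Fin 4, (![(-1 : ℝ), 1, 1, 1] : Fin 4 → ℝ) κ * ℓ (E4.basisVector κ) ^ 2 := by
    intro μ ν
    simp only [Matrix.mul_apply, Fin.sum_univ_four, Matrix.add_apply, Matrix.sub_apply,
      Matrix.smul_apply, Matrix.of_apply, gram_apply, hKc, hcomp, smul_eq_mul]
    fin_cases μ <;> fin_cases ν <;> simp [Matrix.diagonal] <;> ring
  ext μ ν
  have h := key μ ν
  rw [hnull, mul_zero, sub_eq_zero] at h
  exact h

/-! ### The superpotential is affine along the family -/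

/-- **The Landau–Lifshitz superpotential of a Kerr–Schild family is AFFINE in the mass
parameter**: at a null rank-one point, for every `s` and all indices,
`H[g_s]^{μβνα}(y) = H[η]^{μβνα} + s · PP(K_{ρσ}(y))^{μβνα}`, where `PP(X)` is the `X`-linear
part of `H = −d(UU − UU)` at `(D, −1)` (the first summand of
`LandauLifshitz.principalPart_cancel`): the `s²`-coefficient
`φ²(n^μ n^ν n^β n^α − n^β n^ν n^μ n^α)` vanishes identically, and `tr(D X) = φ lᵀ D l = 0`.
Gürses–Gürsey 1975, §IV (linearity of the Kerr–Schild field equations in these variables).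
[cite: KerrSchild1965, §1] -/
theorem superpotential_ksFamily {y : E4} {φ : ℝ} {ℓ : E4 →L[ℝ] ℝ} {n : E4}
    (hn : ∀ w, Minkowski.bilin n w = ℓ w) (hℓ : ℓ n = 0) (hK : K y = φ • E4.tmul ℓ ℓ) (s : ℝ)
    (μ β ν α : Fin 4) :
    superpotential (fun z ↦ Minkowski.bilin + s • K z) y μ β ν α =
      superpotential (fun _ : E4 ↦ Minkowski.bilin) y μ β ν α + s * (-((-1 : ℝ) * Matrix.trace
          ((Matrix.diagonal ![(-1 : ℝ), 1, 1, 1]) * (gram K y))) * ((Matrix.diagonal ![(-1 : ℝ), 1,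
          1, 1]) μ ν * (Matrix.diagonal ![(-1 : ℝ), 1, 1, 1]) β α - (Matrix.diagonal ![(-1 : ℝ), 1,
          1, 1]) β ν * (Matrix.diagonal ![(-1 : ℝ), 1, 1, 1]) μ α) + (-1 : ℝ) * (((Matrix.diagonal
          ![(-1 : ℝ), 1, 1, 1]) * (gram K y) * (Matrix.diagonal ![(-1 : ℝ), 1, 1, 1])) μ ν *
          (Matrix.diagonal ![(-1 : ℝ), 1, 1, 1]) β α + (Matrix.diagonal ![(-1 : ℝ), 1, 1, 1]) μ ν *
          ((Matrix.diagonal ![(-1 : ℝ), 1, 1, 1]) * (gram K y) * (Matrix.diagonal ![(-1 : ℝ), 1, 1,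
          1])) β α - ((Matrix.diagonal ![(-1 : ℝ), 1, 1, 1]) * (gram K y) * (Matrix.diagonal ![(-1
          : ℝ), 1, 1, 1])) β ν * (Matrix.diagonal ![(-1 : ℝ), 1, 1, 1]) μ α - (Matrix.diagonal
          ![(-1 : ℝ), 1, 1, 1]) β ν * ((Matrix.diagonal ![(-1 : ℝ), 1, 1, 1]) * (gram K y) *
          (Matrix.diagonal ![(-1 : ℝ), 1, 1, 1])) μ α)) := by
  obtain ⟨hKc, hcomp, hnull⟩ := nullRankOne_components hn hℓ hK
  have hU := upper_ksFamily hn hℓ hK s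
  have hdet := metricDet_ksFamily hn hℓ hK s
  have hU0 : upper (fun _ : E4 ↦ Minkowski.bilin) y = (Matrix.diagonal ![(-1 : ℝ), 1, 1, 1]) := by
      rw [upper_minkowski, diag_signs_eq]
  have hdet0 := metricDet_minkowski y
  have hX : gram K y = Matrix.of fun i j ↦ φ * ℓ (E4.basisVector i) * ℓ (E4.basisVector j) := by
    ext i j; simp [hKc]
  rw [Fin.sum_univ_four] at hnull
  have htr : Matrix.trace ((Matrix.diagonal ![(-1 : ℝ), 1, 1, 1]) * gram K y) = φ * ∑ κ : Fin 4,
      (![(-1 : ℝ), 1, 1, 1] : Fin 4 → ℝ) κ * ℓ (E4.basisVector κ) ^ 2 := by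
    rw [hX, Matrix.trace]
    simp only [Matrix.diag_apply, Matrix.diagonal_mul, Matrix.of_apply, Fin.sum_univ_four]
    ring
  have hDXD : ∀ i j : Fin 4, ((Matrix.diagonal ![(-1 : ℝ), 1, 1, 1]) * gram K y * (Matrix.diagonal
      ![(-1 : ℝ), 1, 1, 1])) i j = φ * n i * n j := by
    intro i j
    rw [hX, Matrix.mul_diagonal, Matrix.diagonal_mul, Matrix.of_apply, hcomp, hcomp]
    ring
  rw [Fin.sum_univ_four] at htr
  simp only [superpotential, hdet, hU, hdet0, hU0, Matrix.sub_apply, Matrix.of_apply, htr, hDXD]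
  linear_combination (-(s * φ) * ((Matrix.diagonal ![(-1 : ℝ), 1, 1, 1]) μ ν * (Matrix.diagonal
      ![(-1 : ℝ), 1, 1, 1]) β α - (Matrix.diagonal ![(-1 : ℝ), 1, 1, 1]) β ν * (Matrix.diagonal
      ![(-1 : ℝ), 1, 1, 1]) μ α)) * hnull

/-! ### Symmetry and nondegeneracy along the family -/

/-- A null rank-one value is symmetric, hence so is every `g_s(y) = η + s K(y)`. [folklore] -/
theorem ksFamily_apply_symm {y : E4} {φ : ℝ} {ℓ : E4 →L[ℝ] ℝ} (hK : K y = φ • E4.tmul ℓ ℓ)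
    (s : ℝ) (v w : E4) :
    (Minkowski.bilin + s • K y) v w = (Minkowski.bilin + s • K y) w v := by
  simp only [_root_.add_apply, FunLike.coe_smul, Pi.smul_apply, hK, E4.tmul_apply,
    smul_eq_mul, Minkowski.bilin_symm v w]
  ring

/-- **Every member of a Kerr–Schild family is nondegenerate**: `η + s φ ℓ ⊗ ℓ` with `ℓ` null is
invertible for ALL real `s` (pair a kernel vector with `n = ℓ♯` to get `ℓ(v) = 0`, then with
everything). Kerr–Schild 1965, §1. [cite: KerrSchild1965, §1] -/
theorem isInvertible_ksFamily {y : E4} {φ : ℝ} {ℓ : E4 →L[ℝ] ℝ} {n : E4}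
    (hn : ∀ w, Minkowski.bilin n w = ℓ w) (hℓ : ℓ n = 0) (hK : K y = φ • E4.tmul ℓ ℓ) (s : ℝ) :
    (Minkowski.bilin + s • K y).IsInvertible := by
  refine MetricCoord.isInvertible_of_nondegenerate fun v hv ↦ ?_
  have hv' : ∀ w, Minkowski.bilin v w + s * φ * (ℓ v * ℓ w) = 0 := fun w ↦ by
    have h := hv w
    simp only [_root_.add_apply, FunLike.coe_smul, Pi.smul_apply, hK, E4.tmul_apply,
      smul_eq_mul] at h
    linarith
  have hℓv : ℓ v = 0 := by
    have h := hv' n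
    rwa [hℓ, mul_zero, mul_zero, add_zero, Minkowski.bilin_symm, hn] at h
  refine Minkowski.bilin_nondegenerate v fun w ↦ ?_
  have h := hv' w
  rwa [hℓv, zero_mul, mul_zero, add_zero] at h


end KSFlux

end Summit.FinalStateConjecture.FinalStateConjecture.Theorems

end
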